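import Literature.Analysis.Fourier.L2FourierConj
import HarnessLib

/-!
# The multiplication formula `∫ u · 𝓕v = ∫ 𝓕u · v` on `L²`

Analysis/Fourier support file (theorem-only, no definitions, no named facts; RH-FREE real
analysis). For `u, v ∈ L²(V; ℂ)` (`V` a finite-dimensional real inner product space) and Mathlib's
`L²` Fourier transform `𝓕` (`MeasureTheory.Lp.fourierTransformₗᵢ`) with inverse `𝓕⁻`:

* `inner_fourier_right`, `inner_fourier_left`: `⟪f, 𝓕g⟫ = ⟪𝓕⁻f, g⟫`, `⟪𝓕f, g⟫ = ⟪f, 𝓕⁻g⟫`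
  (unitarity, Mathlib `MeasureTheory.Lp.inner_fourier_eq`), for values in any complex Hilbert space;
* `integral_mul_fourier_eq` (**the multiplication formula**): `∫ u(x)·(𝓕v)(x) dx = ∫ (𝓕u)(x)·v(x) dx`
  — Grafakos, Thm. 2.2.14 (1) "`∫ f ĝ = ∫ f̂ g`" for Schwartz functions, here for `L²` classes
  (the extension by density of §2.2.4); proof: `∫ u·𝓕v = ⟪𝖩u, 𝓕v⟫ = ⟪𝓕⁻𝖩u, v⟫ = ⟪𝖩𝓕u, v⟫ =
  ∫ 𝓕u·v` with the conjugation `𝖩` of `L2FourierConj.lean` (`𝓕⁻ ∘ 𝖩 = 𝖩 ∘ 𝓕`).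

## Mathlib search
`MeasureTheory.Lp.inner_fourier_eq`, `MeasureTheory.L2.inner_def`, `RCLike.inner_apply`; the tree's
`Literature.Analysis.Fourier.fourierInv_conjLp` / `coeFn_conjLp`. The `L¹` version is Mathlib's
`VectorFourier.integral_fourierIntegral_smul_eq_flip`; the Schwartz/`L¹` mixed versions are the tree's
`integral_fourier_schwartz_smul_eq` (`PlancherelL1L2.lean`); no `L²`-class statement existed.

## References
* L. Grafakos, *Classical Fourier Analysis*, 3rd ed., GTM 249, Springer 2014: Thm. 2.2.14 (1)
  (PDF p. 128 of the held copy), §2.2.4 (PDF pp. 129–130). [Grafakos2014]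
-/

noncomputable section

open MeasureTheory FourierTransform
open scoped ENNReal ComplexConjugate InnerProductSpace

namespace Literature.Analysis.Fourier

variable {V : Type*} [NormedAddCommGroup V] [InnerProductSpace ℝ V] [FiniteDimensional ℝ V]
  [MeasurableSpace V] [BorelSpace V]
variable {F : Type*} [NormedAddCommGroup F] [InnerProductSpace ℂ F] [CompleteSpace F]

/-- `⟪f, 𝓕g⟫ = ⟪𝓕⁻f, g⟫` in `L²` (the adjoint of the unitary `𝓕` is `𝓕⁻`).
[cite: Grafakos2014, Thm. 2.2.14 (3)–(5), PDF p. 128; §2.2.4, PDF pp. 129–130] -/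
theorem inner_fourier_right (f g : Lp F 2 (volume : Measure V)) :
    ⟪f, (𝓕 g : Lp F 2 (volume : Measure V))⟫_ℂ = ⟪(𝓕⁻ f : Lp F 2 (volume : Measure V)), g⟫_ℂ := by
  have h := Lp.inner_fourier_eq (𝓕⁻ f : Lp F 2 (volume : Measure V)) g
  rwa [fourier_fourierInv_eq] at h

/-- `⟪𝓕f, g⟫ = ⟪f, 𝓕⁻g⟫` in `L²`. [cite: Grafakos2014, Thm. 2.2.14 (3)–(5), PDF p. 128; §2.2.4, PDF pp. 129–130] -/
theorem inner_fourier_left (f g : Lp F 2 (volume : Measure V)) :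
    ⟪(𝓕 f : Lp F 2 (volume : Measure V)), g⟫_ℂ = ⟪f, (𝓕⁻ g : Lp F 2 (volume : Measure V))⟫_ℂ := by
  have h := Lp.inner_fourier_eq f (𝓕⁻ g : Lp F 2 (volume : Measure V))
  rwa [fourier_fourierInv_eq] at h

/-- **The multiplication formula on `L²`**: `∫ u · 𝓕v = ∫ 𝓕u · v` for `u, v ∈ L²(V; ℂ)`
(Grafakos, Thm. 2.2.14 (1), extended from Schwartz functions to `L²` by density).
[cite: Grafakos2014, Thm. 2.2.14 (1), PDF p. 128; §2.2.4, PDF pp. 129–130] -/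
theorem integral_mul_fourier_eq (u v : Lp ℂ 2 (volume : Measure V)) :
    ∫ x, (u : V → ℂ) x * ((𝓕 v : Lp ℂ 2 (volume : Measure V)) : V → ℂ) x =
      ∫ x, ((𝓕 u : Lp ℂ 2 (volume : Measure V)) : V → ℂ) x * (v : V → ℂ) x := by
  set J := ((starₗᵢ ℂ : ℂ ≃ₗᵢ⋆[ℂ] ℂ).toContinuousLinearEquiv : ℂ →L⋆[ℂ] ℂ).compLpL 2
    (volume : Measure V) with hJ
  -- `∫ u · 𝓕v = ⟪𝖩u, 𝓕v⟫`
  have h1 : ∫ x, (u : V → ℂ) x * ((𝓕 v : Lp ℂ 2 (volume : Measure V)) : V → ℂ) x =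
      ⟪(J u : Lp ℂ 2 (volume : Measure V)), (𝓕 v : Lp ℂ 2 (volume : Measure V))⟫_ℂ := by
    rw [L2.inner_def]
    refine integral_congr_ae ?_
    filter_upwards [coeFn_conjLp u] with x hx
    rw [RCLike.inner_apply, hx, Complex.conj_conj, mul_comm]
  -- `⟪𝖩u, 𝓕v⟫ = ⟪𝓕⁻𝖩u, v⟫ = ⟪𝖩𝓕u, v⟫`
  have h2 : ⟪(J u : Lp ℂ 2 (volume : Measure V)), (𝓕 v : Lp ℂ 2 (volume : Measure V))⟫_ℂ =
      ⟪(J (𝓕 u : Lp ℂ 2 (volume : Measure V)) : Lp ℂ 2 (volume : Measure V)), v⟫_ℂ := by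
    rw [inner_fourier_right, hJ, fourierInv_conjLp]
  -- `⟪𝖩𝓕u, v⟫ = ∫ 𝓕u · v`
  have h3 : ⟪(J (𝓕 u : Lp ℂ 2 (volume : Measure V)) : Lp ℂ 2 (volume : Measure V)), v⟫_ℂ =
      ∫ x, ((𝓕 u : Lp ℂ 2 (volume : Measure V)) : V → ℂ) x * (v : V → ℂ) x := by
    rw [L2.inner_def]
    refine integral_congr_ae ?_
    filter_upwards [coeFn_conjLp (𝓕 u : Lp ℂ 2 (volume : Measure V))] with x hx
    rw [RCLike.inner_apply, hx, Complex.conj_conj, mul_comm]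
  rw [h1, h2, h3]

/-- Symmetric form: `∫ 𝓕u · v = ∫ u · 𝓕v`. [cite: Grafakos2014, Thm. 2.2.14 (1), PDF p. 128; §2.2.4, PDF pp. 129–130] -/
theorem integral_fourier_mul_eq (u v : Lp ℂ 2 (volume : Measure V)) :
    ∫ x, ((𝓕 u : Lp ℂ 2 (volume : Measure V)) : V → ℂ) x * (v : V → ℂ) x =
      ∫ x, (u : V → ℂ) x * ((𝓕 v : Lp ℂ 2 (volume : Measure V)) : V → ℂ) x :=
  (integral_mul_fourier_eq u v).symm

end Literature.Analysis.Fourier
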